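import Literature.Computability.Complexity.SmallPrimesCRT
import Literature.Computability.Complexity.ThresholdGadgets
import Literature.Computability.Complexity.ReadOnceAmplification
import HarnessLib

/-!
# Products of selected constants in `TC⁰`: residues modulo small primes by discrete
logarithms, and the CRT quotient, in constant depth

The combinatorial core of ITERATED MULTIPLICATION in `TC⁰` (Vollmer 1999, §1.4.2, Thm. 1.40,
`ITMULT ≤cd MAJ`; Beame–Cook–Hoover 1986) in the special NON-UNIFORM form needed for the
Naor–Reingold functions (Naor–Reingold 2004, §4.2 and Thm. 4.5: both multiple products are of
values "taken from the sequence `a₀, a₁, …, aₙ` or from the set `{g^{2^i}}`", i.e. of HARD-WIRED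
constants SELECTED by input-dependent bits): given

* a realized layer of ONE-HOT groups `[selᵢ x = ρ]` (`i : β`, `β` a finite type in `Type`,
  `ρ < R`) — `ACVecOver tcBasis (oneHotWires sel) d s` — and
* tables of constants `c i ρ` with `∏ᵢ c i (fᵢ) < 2^B` for every choice `f`,

the product `Π(x) = ∏ᵢ c i (selᵢ x)` is made available, at depth `d + 9` and polynomial extra
size `spSize B |β| R`, in CRT form: a new realized layer of one-hot groups (`oneHotWires
(sel' B sel c)`) coding the residues `Π(x) mod p_j` for the primes `p_j` of
`SmallPrimes.primeSet B` (index `some j`) and the CRT quotient `κ(x)` (index `none`), together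
with the exact identity (`prod_add_kap_mul`)

  `Π(x) + κ(x) · M = ∑_j crtT (p_j) (Π(x) mod p_j)`,   `M = ∏_j p_j > 4 · 2^B`,

so that `Π(x)` is a SUM of hard-wired table entries selected by the new one-hot groups, minus a
selected multiple of `M` (`ACVecOver.subsetProd`). The circuit: the residue `[Π ≡ r (mod p)]` is
`[some selected factor ≡ 0]` for `r = 0`, and otherwise `[no selected factor ≡ 0] ∧
[γ^{L(x)} = r]` where `L(x) = ∑ᵢ dlog (c i (selᵢ x))` is a SMALL weighted sum of the one-hot wires
(Vollmer's eq. (1.5); `ThresholdGadgets.acRealOver_wsum_pred`), and `κ` is a predicate of the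
small weighted sum `∑_j ⌊crtT(p_j)(r_j) 2^b / M⌋` of the residue wires
(`SmallPrimes.crtK_eq_approx`). Everything is proved.

## Main statements

* `SubsetProd.pr B j`, `SubsetProd.Rg B`: the primes and the uniform range of the codes;
* `SubsetProd.sel' B sel c`: the new selectors (residues and quotient), `sel'_some_val`,
  `sel'_none_val`, `prod_add_kap_mul`;
* `ACVecOver.subsetProd`: realization at depth `9 + d`, size `spSize B (card β) R + s`.

## References

* H. Vollmer, *Introduction to Circuit Complexity* (1999), §1.4.2, proof of Thm. 1.40
  (eqs. (1.4)–(1.7): residues of a product from discrete logarithms; CRT).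
* M. Naor, O. Reingold, *Number-theoretic constructions of efficient pseudo-random functions*,
  J. ACM 51 (2004), §4.2, §4.2.1 and Thm. 4.5 (p. 252).
* P. Beame, S. Cook, H. J. Hoover, SIAM J. Comput. 15 (1986) 994–1003.
-/

noncomputable section

namespace Literature.Computability.Complexity

open Finset SmallPrimes

namespace SubsetProd

/-! ### The primes, their enumeration and the uniform code range -/

/-- All members of `primeSet B` are primes. [folklore] -/
theorem primeSet_prime (B : ℕ) : ∀ p ∈ primeSet B, p.Prime := fun _ hp => (mem_primeSet.1 hp).2

/-- The number of primes used. [folklore] -/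
def J (B : ℕ) : ℕ := (primeSet B).card

/-- The `j`-th prime of `primeSet B` (increasing enumeration). [folklore] -/
def pr (B : ℕ) (j : Fin (J B)) : ℕ := ((primeSet B).orderIsoOfFin rfl j : ℕ)

/-- `pr B j ∈ primeSet B`. [folklore] -/
theorem pr_mem (B : ℕ) (j : Fin (J B)) : pr B j ∈ primeSet B :=
  Finset.coe_mem _

/-- `pr B j` is prime. [folklore] -/
theorem pr_prime (B : ℕ) (j : Fin (J B)) : (pr B j).Prime := primeSet_prime B _ (pr_mem B j)

/-- The primes as a `Fact` instance (for `ZMod (pr B j)`). [folklore] -/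
instance fact_pr_prime (B : ℕ) (j : Fin (J B)) : Fact (pr B j).Prime := ⟨pr_prime B j⟩

/-- `pr B j ≤ primeBound B`. [folklore] -/
theorem pr_lt (B : ℕ) (j : Fin (J B)) : pr B j < primeBound B + 1 := (mem_primeSet.1 (pr_mem B j)).1

/-- The enumeration is injective. [folklore] -/
theorem pr_injective (B : ℕ) : Function.Injective (pr B) := fun _ _ h =>
  ((primeSet B).orderIsoOfFin rfl).injective (Subtype.ext h)

/-- `J ≤ primeBound B + 1`. [folklore] -/
theorem J_le (B : ℕ) : J B ≤ primeBound B + 1 := by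
  unfold J primeSet
  exact (Finset.card_filter_le _ _).trans (by simp)

/-- The uniform range of all codes of this file: residues (`< p ≤ primeBound B`) and the quotient
(`≤ J`). [folklore] -/
def Rg (B : ℕ) : ℕ := primeBound B + 2

/-- `pr B j < Rg B`. [folklore] -/
theorem pr_lt_Rg (B : ℕ) (j : Fin (J B)) : pr B j < Rg B := (pr_lt B j).trans (Nat.lt_succ_self _)

/-- `J B < Rg B`. [folklore] -/
theorem J_lt_Rg (B : ℕ) : J B < Rg B := Nat.lt_succ_of_le (J_le B)

/-- The modulus `M = ∏ p` exceeds `4 · 2^B`. [folklore] -/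
theorem four_mul_two_pow_lt_crtM (B : ℕ) : 4 * 2 ^ B < crtM (primeSet B) :=
  four_mul_two_pow_lt_primorial B

/-- Sums over `primeSet B` as sums over the enumeration. [folklore] -/
theorem sum_primeSet_eq (B : ℕ) (f : ℕ → ℕ) : ∑ p ∈ primeSet B, f p = ∑ j : Fin (J B), f (pr B j) := by
  rw [← Finset.sum_coe_sort (primeSet B) f]
  exact (Equiv.sum_comp ((primeSet B).orderIsoOfFin rfl).toEquiv (fun p : primeSet B => f p)).symm

/-! ### Discrete logarithms, repackaged over `ℕ`

To keep the arithmetic of `ZMod p` (whose instances are defined by case analysis on `p`) out of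
statements in which `p` is a large closed expression, the discrete-logarithm data of
`SmallPrimes.DlogData` are repackaged with natural-number values only. -/

/-- Discrete-logarithm data modulo a prime `p`, with values in `ℕ`: a generator representative
`g`, logarithms `lg c < p`, non-vanishing of the powers of `g` modulo `p`, and the residue of a
product of naturals as `g ^ (∑ lg) mod p` unless some factor is `≡ 0` (Vollmer's `g_j`, `m_j`,
eqs. (1.5)–(1.6)). [cite: Vollmer1999, §1.4.2, proof of Thm. 1.40, eqs. (1.4)–(1.6)] -/
structure NatDlog (p : ℕ) : Type 1 where
  /-- a generator of the non-zero residues, as a natural number -/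
  g : ℕ
  /-- the logarithm of (the residue of) a natural number -/
  lg : ℕ → ℕ
  /-- logarithms are `< p` -/
  lg_lt : ∀ c, lg c < p
  /-- powers of the generator are non-zero modulo `p` -/
  pow_mod_ne_zero : ∀ k, g ^ k % p ≠ 0
  /-- the residue of a product -/
  prod_mod : ∀ {β : Type} (s : Finset β) (m : β → ℕ),
    (∏ i ∈ s, m i) % p = if ∃ i ∈ s, p ∣ m i then 0 else g ^ (∑ i ∈ s, lg (m i)) % p

/-- **Existence of the `ℕ`-valued discrete-logarithm data** (from `SmallPrimes.exists_dlogData`;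
product index types in `Type`). [cite: Vollmer1999, §1.4.2, proof of Thm. 1.40, and Appendix A8] -/
theorem exists_natDlog (p : ℕ) [hp : Fact p.Prime] : Nonempty (NatDlog p) := by
  classical
  obtain ⟨D⟩ := exists_dlogData p
  refine ⟨⟨D.γ.val, fun c => D.dlog (c : ZMod p), fun c => D.dlog_lt _, fun k => ?_, fun s m => ?_⟩⟩
  · rw [← ZMod.val_natCast, Nat.cast_pow, ZMod.natCast_zmod_val, ZMod.val_ne_zero]
    exact D.pow_ne_zero k
  · rw [prod_mod_eq D s m]
    have hiff : (∃ i ∈ s, ((m i : ℕ) : ZMod p) = 0) ↔ ∃ i ∈ s, p ∣ m i := by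
      simp only [ZMod.natCast_eq_zero_iff]
    by_cases h : ∃ i ∈ s, p ∣ m i
    · rw [if_pos (hiff.2 h), if_pos h]
    · rw [if_neg (fun h' => h (hiff.1 h')), if_neg h, ← ZMod.val_natCast, Nat.cast_pow,
        ZMod.natCast_zmod_val]

/-- Discrete-logarithm data modulo each prime of `primeSet B`. [folklore] -/
def ND (B : ℕ) (j : Fin (J B)) : NatDlog (pr B j) := Classical.choice (exists_natDlog (pr B j))

/-! ### The product, its residues and CRT quotient, and the new selectors -/

section Sel

variable {ι : Type*} {β : Type} [Fintype β] {R : ℕ} (B : ℕ) (sel : (ι → Bool) → β → Fin R)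
  (c : β → Fin R → ℕ)

/-- The product of the selected constants `Π(x) = ∏ᵢ c i (selᵢ x)`. [cite: NaorReingold2004, §4.2 (multiple product of preprocessed values)] -/
def sprod (x : ι → Bool) : ℕ := ∏ i, c i (sel x i)

/-- The residue of the product modulo the `j`-th prime, as a code `< Rg B`. [cite: Vollmer1999, §1.4.2, proof of Thm. 1.40, eq. (1.6)] -/
def res (x : ι → Bool) (j : Fin (J B)) : Fin (Rg B) :=
  ⟨sprod sel c x % pr B j, (Nat.mod_lt _ (pr_prime B j).pos).trans (pr_lt_Rg B j)⟩

/-- The CRT quotient `κ(x)`, as a code `< Rg B`. [cite: Vollmer1999, §1.4.2, proof of Thm. 1.40 (the quotient `q`)] -/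
def kap (x : ι → Bool) : Fin (Rg B) :=
  ⟨crtK (primeSet B) (sprod sel c x),
    (crtK_lt (primeSet B) (primeSet_prime B) _).trans_le (Nat.succ_le_of_lt (J_lt_Rg B))⟩

/-- **The new selectors**: `none ↦ κ(x)`, `some j ↦ Π(x) mod p_j`. [cite: Vollmer1999, §1.4.2, proof of Thm. 1.40] -/
def sel' (x : ι → Bool) : Option (Fin (J B)) → Fin (Rg B)
  | none => kap B sel c x
  | some j => res B sel c x j

/-- `sel' x (some j) = Π(x) mod p_j`. [folklore] -/
@[simp] theorem sel'_some_val (x : ι → Bool) (j : Fin (J B)) :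
    (sel' B sel c x (some j) : ℕ) = sprod sel c x % pr B j := rfl

/-- `sel' x none = κ(x)`. [folklore] -/
@[simp] theorem sel'_none_val (x : ι → Bool) :
    (sel' B sel c x none : ℕ) = crtK (primeSet B) (sprod sel c x) := rfl

/-- **The CRT identity for the product**: if all products are `< 2^B` then
`Π(x) + κ(x)·M = ∑_j crtT (p_j) (Π(x) mod p_j)` with `M = crtM (primeSet B)`. [cite: Vollmer1999, §1.4.2, proof of Thm. 1.40, eq. (1.7) and `a = a' − q·p`] -/
theorem prod_add_kap_mul (hc : ∀ f : β → Fin R, ∏ i, c i (f i) < 2 ^ B) (x : ι → Bool) :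
    sprod sel c x + (sel' B sel c x none : ℕ) * crtM (primeSet B) =
      ∑ j : Fin (J B), crtT (primeSet B) (pr B j) (sel' B sel c x (some j)) := by
  have hE : sprod sel c x < crtM (primeSet B) := by
    have h1 := hc fun i => sel x i
    have h2 := four_mul_two_pow_lt_crtM B
    unfold sprod; omega
  have h := crtSum_eq (primeSet B) (primeSet_prime B) hE
  simp only [sel'_none_val, sel'_some_val]
  unfold crtSum at h
  rw [sum_primeSet_eq] at h
  omega

end Sel

/-! ### The residue formulas over the one-hot wires -/

section Residues

variable {ι : Type*} {β : Type} [Fintype β] {R : ℕ} (B : ℕ) (sel : (ι → Bool) → β → Fin R)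
  (c : β → Fin R → ℕ)

/-- "Some selected factor is `≡ 0 (mod p_j)`", as a formula of the one-hot wires. [cite: Vollmer1999, §1.4.2, proof of Thm. 1.40 ("the particular case that one of the `aᵢ mod p_j` is equal to 0")] -/
def zeroF (j : Fin (J B)) (z : β × Fin R → Bool) : Bool :=
  decide (∃ k : {k : β × Fin R // pr B j ∣ c k.1 k.2}, z k.1 = true)

/-- The discrete-logarithm weights `dlog_j (c i ρ)` on the wire `(i, ρ)`. [cite: Vollmer1999, §1.4.2, proof of Thm. 1.40, eq. (1.4)] -/
def dlWt (j : Fin (J B)) (k : β × Fin R) : ℕ := (ND B j).lg (c k.1 k.2)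

/-- The sum of logarithms `L_j(x) = ∑ᵢ dlog_j (c i (selᵢ x))` is the weighted sum of the one-hot
wires. [cite: Vollmer1999, §1.4.2, proof of Thm. 1.40, eq. (1.5)] -/
theorem wsum_dlWt (j : Fin (J B)) (x : ι → Bool) :
    wsum (dlWt B c j) (oneHotWires sel x) = ∑ i, (ND B j).lg (c i (sel x i)) := by
  rw [wsum_oneHotWires]; rfl

/-- Bound on the total logarithm weight. [folklore] -/
def RL (B Nβ R : ℕ) : ℕ := Nβ * R * Rg B + 1

/-- The total logarithm weight is `< RL`. [folklore] -/
theorem sum_dlWt_lt (j : Fin (J B)) : (∑ k : β × Fin R, dlWt B c j k) < RL B (Fintype.card β) R := by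
  unfold RL
  have h : ∀ k : β × Fin R, dlWt B c j k ≤ Rg B := fun k =>
    ((ND B j).lg_lt _).le.trans (pr_lt_Rg B j).le
  calc (∑ k : β × Fin R, dlWt B c j k) ≤ ∑ _k : β × Fin R, Rg B := Finset.sum_le_sum fun k _ => h k
    _ = Fintype.card β * R * Rg B := by simp [Finset.sum_const, Fintype.card_prod, mul_assoc]
    _ < _ := Nat.lt_succ_self _

/-- Semantics of `zeroF`. [folklore] -/
theorem zeroF_oneHot (j : Fin (J B)) (x : ι → Bool) :
    zeroF B c j (oneHotWires sel x) = decide (∃ i, pr B j ∣ c i (sel x i)) := by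
  unfold zeroF
  rw [decide_eq_decide]
  constructor
  · rintro ⟨⟨⟨i, ρ⟩, hk⟩, hz⟩
    simp only [oneHotWires_apply, decide_eq_true_eq] at hz
    exact ⟨i, by rw [hz]; exact hk⟩
  · rintro ⟨i, hi⟩
    exact ⟨⟨(i, sel x i), hi⟩, by simp⟩

/-- **The residue of the product** (Vollmer's eqs. (1.5)–(1.6)): modulo `p_j`, `Π(x)` is `0`
iff some selected factor is `≡ 0`, and otherwise it is the canonical representative of
`γ_j ^ L_j(x)`. [cite: Vollmer1999, §1.4.2, proof of Thm. 1.40, eqs. (1.5)–(1.6)] -/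
theorem sprod_mod_pr (j : Fin (J B)) (x : ι → Bool) :
    sprod sel c x % pr B j =
      if ∃ i, pr B j ∣ c i (sel x i) then 0
      else (ND B j).g ^ (∑ i, (ND B j).lg (c i (sel x i))) % pr B j := by
  unfold sprod
  rw [(ND B j).prod_mod Finset.univ (fun i => c i (sel x i))]
  by_cases h : ∃ i, pr B j ∣ c i (sel x i)
  · rw [if_pos h, if_pos (by simpa using h)]
  · rw [if_neg h, if_neg (by simpa using h)]

/-- The target predicate of the logarithm sum for a non-zero residue `r`:
`[g_j ^ v mod p_j = r]`. [folklore] -/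
def resP (j : Fin (J B)) (r : ℕ) (v : ℕ) : Prop := (ND B j).g ^ v % pr B j = r

/-- `resP` is decidable. [folklore] -/
instance decResP (j : Fin (J B)) (r v : ℕ) : Decidable (resP B j r v) := inferInstanceAs (Decidable (_ = _))

/-- Semantics of the residue wires: for `r = 0`. [cite: Vollmer1999, §1.4.2, proof of Thm. 1.40] -/
theorem res_eq_zero_iff (j : Fin (J B)) (x : ι → Bool) :
    sprod sel c x % pr B j = 0 ↔ ∃ i, pr B j ∣ c i (sel x i) := by
  rw [sprod_mod_pr]
  split_ifs with h
  · simp [h]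
  · simp only [h, iff_false]
    exact (ND B j).pow_mod_ne_zero _

/-- Semantics of the residue wires: for `r ≠ 0`. [cite: Vollmer1999, §1.4.2, proof of Thm. 1.40] -/
theorem res_eq_iff_of_ne_zero (j : Fin (J B)) (x : ι → Bool) {r : ℕ} (hr : r ≠ 0) :
    sprod sel c x % pr B j = r ↔
      ¬ (∃ i, pr B j ∣ c i (sel x i)) ∧ resP B j r (wsum (dlWt B c j) (oneHotWires sel x)) := by
  rw [wsum_dlWt, sprod_mod_pr]
  unfold resP
  split_ifs with h
  · simp only [h, not_true_eq_false, false_and, iff_false]; exact fun h0 => hr h0.symm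
  · simp [h]

end Residues

/-! ### The circuit -/

section Circuit

variable {ι : Type*} {β : Type} [Fintype β] {R : ℕ} (B : ℕ) (sel : (ι → Bool) → β → Fin R)
  (c : β → Fin R → ℕ)

/-- Size of the logarithm-sum predicate block. [folklore] -/
def SP (B Nβ R : ℕ) : ℕ := RL B Nβ R * (4 * (RL B Nβ R + RL B Nβ R) + 11) + 1

/-- Size of one residue block. [folklore] -/
def SR (B Nβ R : ℕ) : ℕ := 2 * (SP B Nβ R + 2) + 1

/-- Bound on the total quotient weight. [folklore] -/
def RK (B : ℕ) : ℕ := J B * Rg B * (4 * J B + 1) + 1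

/-- Size of one quotient block. [folklore] -/
def SK (B : ℕ) : ℕ := RK B * (4 * (RK B + RK B) + 11) + 1

/-- **Extra size of the subset-product layer** (a polynomial in `B`, `|β|`, `R`). [folklore] -/
def spSize (B Nβ R : ℕ) : ℕ := J B * Rg B * SR B Nβ R + (J B + 1) * Rg B * SK B

/-- The residue wire formula `[Π(x) ≡ r (mod p_j)]` over the one-hot wires. [cite: Vollmer1999, §1.4.2, proof of Thm. 1.40, eqs. (1.5)–(1.6)] -/
def resF (j : Fin (J B)) (r : Fin (Rg B)) (z : β × Fin R → Bool) : Bool :=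
  if (r : ℕ) = 0 then zeroF B c j z
  else (!zeroF B c j z && decide (resP B j r (wsum (dlWt B c j) z)))

/-- Semantics of the residue formula: the one-hot code of the residue. [folklore] -/
theorem resF_oneHot (j : Fin (J B)) (r : Fin (Rg B)) (x : ι → Bool) :
    resF B c j r (oneHotWires sel x) = oneHotWires (sel' B sel c) x (some j, r) := by
  rw [oneHotWires_apply]
  unfold resF
  split_ifs with hr
  · rw [zeroF_oneHot]
    apply decide_eq_decide.2
    rw [← res_eq_zero_iff B sel c j x, Fin.ext_iff, sel'_some_val, hr]
  · rw [zeroF_oneHot]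
    have key := res_eq_iff_of_ne_zero B sel c j x hr
    have e : (sel' B sel c x (some j) = r) ↔ sprod sel c x % pr B j = (r : ℕ) := by
      rw [Fin.ext_iff, sel'_some_val]
    rw [show decide (sel' B sel c x (some j) = r) = decide (sprod sel c x % pr B j = (r : ℕ)) from
      decide_eq_decide.2 e]
    by_cases h1 : ∃ i, pr B j ∣ c i (sel x i)
    · have : ¬ (sprod sel c x % pr B j = (r : ℕ)) := fun h => (key.1 h).1 h1
      simp [h1, this]
    · by_cases h2 : resP B j r (wsum (dlWt B c j) (oneHotWires sel x))
      · have : sprod sel c x % pr B j = (r : ℕ) := key.2 ⟨h1, h2⟩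
        simp [h1, h2, this]
      · have : ¬ (sprod sel c x % pr B j = (r : ℕ)) := fun h => h2 (key.1 h).2
        simp [h1, h2, this]

/-- Realization of `zeroF`: one `∨` gate. [folklore] -/
theorem acRealOver_zeroF (j : Fin (J B)) : ACRealOver tcBasis (zeroF B c j : (β × Fin R → Bool) → Bool) 1 1 := by
  have h := acRealOver_exists_fintype acBasis_subset_tcBasis
    (f := fun (k : {k : β × Fin R // pr B j ∣ c k.1 k.2}) (z : β × Fin R → Bool) => z k.1)
    (d := 0) (s := 0) fun k => acRealOver_input tcBasis _
  refine (h.congr fun z => rfl).mono le_rfl (by simp)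

/-- Realization of one residue wire: depth `5`, size `SR`. [cite: Vollmer1999, §1.4.2, proof of Thm. 1.40] -/
theorem acRealOver_resF (j : Fin (J B)) (r : Fin (Rg B)) :
    ACRealOver tcBasis (resF B c j r : (β × Fin R → Bool) → Bool) 5 (SR B (Fintype.card β) R) := by
  unfold resF SR
  split_ifs with hr
  · exact (acRealOver_zeroF B c j).mono (by norm_num) (by omega)
  · -- `¬zero ∧ resP(L)`
    have h1 : ACRealOver tcBasis (fun z : β × Fin R → Bool => !zeroF B c j z) 4 (SP B (Fintype.card β) R + 2) :=
      ((acRealOver_zeroF B c j).neg not_mem_tcBasis).mono (by norm_num) (by omega)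
    have h2 : ACRealOver tcBasis
        (fun z : β × Fin R → Bool => decide (resP B j r (wsum (dlWt B c j) z))) 4
        (SP B (Fintype.card β) R + 2) := by
      refine (acRealOver_wsum_pred (dlWt B c j) (sum_dlWt_lt B c j) (resP B j r)).mono le_rfl ?_
      unfold SP
      have := sum_dlWt_lt B c j
      nlinarith
    have h := acRealOver_forall_const acBasis_subset_tcBasis
      (f := fun (k : Fin 2) (z : β × Fin R → Bool) =>
        ![!zeroF B c j z, decide (resP B j r (wsum (dlWt B c j) z))] k) (fun k => by
        fin_cases k
        · exact h1
        · exact h2)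
    refine (h.congr fun z => ?_).mono le_rfl le_rfl
    simp [Fin.forall_fin_two, Bool.and_comm]

/-- **The residue layer**: all one-hot residue codes, depth `5`, size `J · Rg · SR`. [cite: Vollmer1999, §1.4.2, proof of Thm. 1.40] -/
theorem acVecOver_res :
    ACVecOver tcBasis (fun (z : β × Fin R → Bool) (jr : Fin (J B) × Fin (Rg B)) => resF B c jr.1 jr.2 z)
      5 (J B * Rg B * SR B (Fintype.card β) R) := by
  have h := acVecOver_ofBlocks_fintype_const (B := tcBasis)
    (f := fun (jr : Fin (J B) × Fin (Rg B)) (z : β × Fin R → Bool) => resF B c jr.1 jr.2 z)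
    fun jr => acRealOver_resF B c jr.1 jr.2
  simpa [Fintype.card_prod, Fintype.card_fin] using h

/-- The truncated-fraction weights `ũ_j(r)` on the residue wire `(j, r)`. [folklore] -/
def uWt (jr : Fin (J B) × Fin (Rg B)) : ℕ := apxU (primeSet B) (pr B jr.1) jr.2

/-- The total quotient weight is `< RK`. [folklore] -/
theorem sum_uWt_lt : (∑ jr : Fin (J B) × Fin (Rg B), uWt B jr) < RK B := by
  unfold RK
  have hb := two_pow_apxB_le (primeSet B)
  have h : ∀ jr : Fin (J B) × Fin (Rg B), uWt B jr ≤ 4 * J B + 1 := fun jr =>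
    (apxU_lt (primeSet B) (primeSet_prime B) _ _).le.trans hb
  calc (∑ jr : Fin (J B) × Fin (Rg B), uWt B jr) ≤ ∑ _jr : Fin (J B) × Fin (Rg B), (4 * J B + 1) :=
        Finset.sum_le_sum fun jr _ => h jr
    _ = J B * Rg B * (4 * J B + 1) := by simp [Finset.sum_const, Fintype.card_prod]
    _ < _ := Nat.lt_succ_self _

/-- The weighted sum of the residue wires is `∑_j ũ_j (Π mod p_j)`. [folklore] -/
theorem wsum_uWt (x : ι → Bool) :
    wsum (uWt B) (oneHotWires (res B sel c) x) = ∑ j, apxU (primeSet B) (pr B j) (sprod sel c x % pr B j) := by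
  rw [show uWt B = fun jr : Fin (J B) × Fin (Rg B) => apxU (primeSet B) (pr B jr.1) jr.2 from rfl,
    wsum_oneHotWires]
  rfl

/-- The quotient predicate `[(v + J) / 2^b = k]`. [folklore] -/
def kapP (k v : ℕ) : Prop := (v + J B) / 2 ^ apxB (primeSet B) = k

/-- `kapP` is decidable. [folklore] -/
instance decKapP (k v : ℕ) : Decidable (kapP B k v) := inferInstanceAs (Decidable (_ = _))

/-- **Semantics of the quotient predicate** (`SmallPrimes.crtK_eq_approx`): on the residue codes
of `x`, `kapP k` holds iff `κ(x) = k`, provided all products are `< 2^B`. [folklore] -/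
theorem kapP_iff (hc : ∀ f : β → Fin R, ∏ i, c i (f i) < 2 ^ B) (k : ℕ) (x : ι → Bool) :
    kapP B k (wsum (uWt B) (oneHotWires (res B sel c) x)) ↔ crtK (primeSet B) (sprod sel c x) = k := by
  unfold kapP
  rw [wsum_uWt, crtK_eq_approx (primeSet B) (primeSet_prime B), sum_primeSet_eq]
  · rfl
  · calc 4 * sprod sel c x < 4 * 2 ^ B := by
          have := hc fun i => sel x i; unfold sprod; omega
      _ < crtM (primeSet B) := four_mul_two_pow_lt_crtM B

/-- The output formulas over the residue wires: quotient blocks and passed-through residues. [folklore] -/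
def outF : Option (Fin (J B)) × Fin (Rg B) → (Fin (J B) × Fin (Rg B) → Bool) → Bool
  | (none, k) => fun zr => decide (kapP B k (wsum (uWt B) zr))
  | (some j, r) => fun zr => zr (j, r)

/-- Realization of the output formulas: depth `4`, size `SK` each. [folklore] -/
theorem acRealOver_outF (o : Option (Fin (J B)) × Fin (Rg B)) : ACRealOver tcBasis (outF B o) 4 (SK B) := by
  rcases o with ⟨_ | j, r⟩
  · change ACRealOver tcBasis (fun zr => decide (kapP B r (wsum (uWt B) zr))) 4 (SK B)
    refine (acRealOver_wsum_pred (uWt B) (sum_uWt_lt B) (kapP B r)).mono le_rfl ?_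
    unfold SK
    have := sum_uWt_lt B
    nlinarith
  · change ACRealOver tcBasis (fun zr : Fin (J B) × Fin (Rg B) → Bool => zr (j, r)) 4 (SK B)
    exact (acRealOver_input tcBasis _).mono (Nat.zero_le _) (Nat.zero_le _)

/-- The output layer over the residue wires: depth `4`, size `(J+1) · Rg · SK`. [folklore] -/
theorem acVecOver_outF :
    ACVecOver tcBasis (fun (zr : Fin (J B) × Fin (Rg B) → Bool) o => outF B o zr) 4 ((J B + 1) * Rg B * SK B) := by
  have h := acVecOver_ofBlocks_fintype_const (B := tcBasis) (f := fun o zr => outF B o zr)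
    fun o => acRealOver_outF B o
  simpa [Fintype.card_prod, Fintype.card_option, Fintype.card_fin] using h

/-- **Products of selected constants in `TC⁰` (CRT form).** Given a realized layer of one-hot
groups `[selᵢ x = ρ]` of depth `d` and size `s`, and constants `c i ρ` all of whose selections
have product `< 2^B`, the one-hot codes of the residues `Π(x) mod p_j` (`p_j ∈ primeSet B`) and
of the CRT quotient `κ(x)` — the layer `oneHotWires (sel' B sel c)` — are realized over `tcBasis`
at depth `d + 9` with `spSize B |β| R + s` gates; by `prod_add_kap_mul`,
`Π(x) = ∑_j crtT (p_j) (Π mod p_j) − κ(x)·M` is then a signed sum of selected table entries. [cite: Vollmer1999, §1.4.2, proof of Thm. 1.40 (`ITMULT ≤cd MAJ`)] [cite: NaorReingold2004, §4.2.1 and Thm. 4.5 (p. 252)] -/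
theorem _root_.Literature.Computability.Complexity.ACVecOver.subsetProd {d s : ℕ}
    (h : ACVecOver tcBasis (oneHotWires sel) d s) (hc : ∀ f : β → Fin R, ∏ i, c i (f i) < 2 ^ B) :
    ACVecOver tcBasis (oneHotWires (sel' B sel c)) (9 + d) (spSize B (Fintype.card β) R + s) := by
  have hres := (acVecOver_res B c).comp h
  have hout := (acVecOver_outF B).comp hres
  refine (hout.congr fun x o => ?_).mono (by omega) (by unfold spSize; omega)
  -- semantics
  have hz : (fun jr : Fin (J B) × Fin (Rg B) => resF B c jr.1 jr.2 (oneHotWires sel x)) =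
      oneHotWires (res B sel c) x := by
    funext jr
    rw [resF_oneHot]
    rfl
  rcases o with ⟨_ | j, r⟩
  · change decide (kapP B r (wsum (uWt B) fun jr => resF B c jr.1 jr.2 (oneHotWires sel x))) = _
    rw [hz, oneHotWires_apply]
    apply decide_eq_decide.2
    rw [kapP_iff B sel c hc, Fin.ext_iff, sel'_none_val]
  · change resF B c j r (oneHotWires sel x) = _
    exact resF_oneHot B sel c j r x

end Circuit

end SubsetProd

end Literature.Computability.Complexity
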